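import Summits.BirchSwinnertonDyer.BirchSwinnertonDyer.Theorems.CumulativeHeegnerLeopoldtCumulativeHeegnerInclusionAtThreeResidualDevissage
import Summits.BirchSwinnertonDyer.BirchSwinnertonDyer.Theorems.CumulativeHeegnerLeopoldtCumulativeHeegnerInclusionAtThreeLineBaseChange
import Summits.BirchSwinnertonDyer.BirchSwinnertonDyer.Theorems.CumulativeHeegnerLeopoldtCumulativeHeegnerInclusionAtThreeTowerFixed
import Summits.BirchSwinnertonDyer.Rank1Residual.Additive.PotSupersingularClasses
import Literature.NumberTheory.EllipticCurves.CastellaGrossiLeeSkinner2022.ResidualCharacterSelmerFinite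
import Literature.NumberTheory.EllipticCurves.AnticyclotomicPrimeDecompositionAboveProofs
import Literature.NumberTheory.EllipticCurves.HeegnerPoints
import HarnessLib

/-!
# Crux K1 `CumulativeHeegnerInclusionAtThree` (stmt-BirchSwinnertonDyer-24198), line `birth` — STUB B1
# `stub_residualSelmerFinite` FROM PRINT: «`Sel_{𝔭′}(K_∞, E[3^∞])[3]` finite on the Leopoldt cell» ⟸
# Castella–Grossi–Lee–Skinner 2022 Prop. 14 (typed named fact) + two kernel-size bookkeeping statements

Lead prover bsd-line-chl-k1-p1 g2 (`--supports stmt-BirchSwinnertonDyer-24198`). This file composes the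
landed pieces of the B1 port —
`…ResidualDevissage.finite_selmerAc_empty_pTorsion_of_line_devissage` (CGLS Prop. 17 + Lim–Sujatha Kummer
step, p609974), `…LineBaseChange` (the rational line over `K`, `D_𝔓 ↔ D_{𝔭′}` at a degree-one prime,
p611257), `…TowerFixed` (no fixed vectors up the `ℤ_3`-tower, p611775), Brink's
`decomp_not_le_kerSubgroup_above_of_isAnticyclotomic_holds` — into

  **`stub_residualSelmerFinite_of_print`** : `prop14_residualCharacterSelmer_finite` (CGLS22 Prop. 14,
  Literature named fact, p610776) → `LineDeterminantAtThree` → `BadPlacesSplitFinite` → STUB B1 verbatim,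

where the two remaining hypotheses are KERNEL-SIZE bookkeeping, spelled out in full in the signature (no
definition is introduced) so that the line's skeleton can register them as stubs:
* `LineDeterminantAtThree` («det on a stable line»): for a `Γ_K`-stable line `S ≤ E_K[3]` of order `3`, an
  element acting as the integer `a` on `S` and as `d` on `E_K[3]/S` has mod-`3` cyclotomic character
  `a·d` — the Weil pairing `det ρ̄_{E,3} = χ₃` (tree `det_eq_modNCyclotomicCharacter`) read on an adapted
  basis; it converts the crux's non-anomalous clause «`φ|D ≠ 1`, `ψ|D ≠ 1`» into CGLS's «`θ|D ∉ {1, ω}`»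
  for both characters (`φψ = ω`).
* `BadPlacesSplitFinite`: the places of the Heegner field `K` prime to `3` where `E_K` has bad reduction
  form a finite set of places lying over rational primes SPLIT in `K` (they divide `N`, and every `ℓ ∣ N`
  splits by the Heegner hypothesis) — the `Σ` of CGLS §1.4.
BSD is not proved by any of this; B1 becomes «print (Rubin 1991 + Hida 2010 via CGLS22 Prop. 14) + two
provable bookkeeping stubs». THEOREMS ONLY; no definition, no `sorry`; imports no `Theses` module.
References: [CastellaGrossiLeeSkinner2022] §1 (arXiv:2008.02571) Props. 14, 17, 18; [GreenbergVatsal2000]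
§2; [Brink2007] Cor. 1; [SilvermanCSS1997] Ch. II §7–8 (Weil pairing determinant).
-/

set_option autoImplicit false
-- `…BirchSwinnertonDyer.BirchSwinnertonDyer.Theorems…` is the problem's mandated namespace (D-0017).
set_option linter.dupNamespace false

noncomputable section

open scoped Classical

namespace Summit.BirchSwinnertonDyer.BirchSwinnertonDyer.Theorems.CumulativeHeegnerInclusionAtThreeB1OfPrint

open NumberField IsDedekindDomain Field WeierstrassCurve
open Literature.NumberTheory.EllipticCurves Literature.NumberTheory.EllipticCurves.GreenbergSelmer
  Literature.NumberTheory.EllipticCurves.GreenbergVatsal2000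
  Literature.NumberTheory.GaloisRepresentations IsDedekindDomain.HeightOneSpectrum
  Literature.NumberTheory.EllipticCurves.Rank1Residual
  Summit.BirchSwinnertonDyer.Rank1Residual.X11b Summit.BirchSwinnertonDyer.Rank1Residual.X11b.AcSelmer
  Summit.BirchSwinnertonDyer.Rank1Residual.X2.ResidualDevissageModules
  Summit.BirchSwinnertonDyer.Rank1Residual.X2.PrimeOrderCharacters
  Summit.BirchSwinnertonDyer.BirchSwinnertonDyer.Theorems.CumulativeHeegnerInclusionAtThreeResidualDevissage
  Summit.BirchSwinnertonDyer.BirchSwinnertonDyer.Theorems.CumulativeHeegnerInclusionAtThreeLineBaseChange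
  Summit.BirchSwinnertonDyer.BirchSwinnertonDyer.Theorems.CumulativeHeegnerInclusionAtThreeTowerFixed
  Summit.BirchSwinnertonDyer.BirchSwinnertonDyer.Theorems.AdditiveKoly.SplitCompletion

/-- **STUB B1 of line `birth` from print.** On the Leopoldt cell of crux K1 (`E/ℚ` with `ClassO6` at `3`,
`E[3]` reducible with a rational line `Φ` that is NON-ANOMALOUS at `3`, `K` imaginary quadratic Heegner for
`N = N_E`, `κ` anticyclotomic, `𝔭′ ∋ 3`), Castella's anticyclotomic Selmer group has finite `3`-torsion,
`{s ∈ Sel_{𝔭′}(K_∞, E[3^∞]) | 3 s = 0}` finite, GIVEN (1) the Literature named fact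
`CastellaGrossiLeeSkinner2022.prop14_residualCharacterSelmer_finite` (CGLS22 Prop. 14: residual Selmer
groups of characters of `K` are finite; printed proof Rubin 1991 + Hida 2010), (2) the determinant-on-a-line
statement for `E_K[3]` (Weil pairing, kernel-size), (3) finiteness and splitness of the bad places of `E_K`
prime to `3` (kernel-size). Proof: `3 ∣ N` (additive) so `3` splits in `K` and `𝔭′` has `e = f = 1`; the
line `Φ` base-changes to a `Γ_K`-stable `S ≤ E_K[3]` of order `3` with quotient of order `3`
(`…LineBaseChange`); the non-anomalous clause at the primes of `\bar ℤ` above `3` gives «`D_{𝔭′}` acts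
non-trivially on `S` and on `E_K[3]/S`» (`…LineBaseChange`, degree one), hence no `G_{K_{∞,𝔭′}}`-fixed
vector in the quotient (`…TowerFixed`) and, with (2), CGLS's hypotheses «`θ|_{D} ∉ {1, ω}`» for both
characters; (1) then gives the finiteness of the residual Selmer groups of `S` and `E_K[3]/S`, and the
devissage + Kummer step (`finite_selmerAc_empty_pTorsion_of_line_devissage`, with Brink's
`D_{𝔭′} ⊄ ker κ`) concludes. [cite: CastellaGrossiLeeSkinner2022, §1 Props. 14, 17, 18 (arXiv:2008.02571)] [cite: Brink2007, Cor. 1] -/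
theorem stub_residualSelmerFinite_of_print
    (hfact : CastellaGrossiLeeSkinner2022.prop14_residualCharacterSelmer_finite)
    (hdet : ∀ (K : Type) [Field K] [NumberField K] (E : WeierstrassCurve K) [E.IsElliptic]
      (S : StableSubgroup (absoluteGaloisGroup K) (E.geomTorsion ((3 : ℕ) : ℤ))),
      Nat.card S.Sub = 3 → ∀ (g : absoluteGaloisGroup K) (a d : ℕ),
        (∀ x : S.Sub, g • x = a • x) → (∀ y : S.Quot, g • y = d • y) →
        ((a * d : ℕ) : ZMod 3) = ((modNCyclotomicCharacter K 3 g : (ZMod 3)ˣ) : ZMod 3))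
    (hbad : ∀ (W : WeierstrassCurve ℚ) [W.IsElliptic] [W.IsGloballyMinimal] (N : ℕ) [NeZero N]
      (K : Type) [Field K] [NumberField K], W.conductorNorm ℤ = N →
      Literature.NumberTheory.EllipticCurves.IsImaginaryQuadratic K →
      Literature.NumberTheory.EllipticCurves.SatisfiesHeegnerHypothesis N K →
      {v : HeightOneSpectrum (𝓞 K) | ((3 : ℕ) : 𝓞 K) ∉ v.asIdeal ∧
          ¬ (W.baseChange K).HasGoodReductionAt v}.Finite ∧
        ∀ v : HeightOneSpectrum (𝓞 K), ((3 : ℕ) : 𝓞 K) ∉ v.asIdeal →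
          ¬ (W.baseChange K).HasGoodReductionAt v → ((v.asIdeal.under ℤ).primesOver (𝓞 K)).ncard = 2) :
    ∀ (W : WeierstrassCurve ℚ) [W.IsElliptic] [W.IsGloballyMinimal] (N : ℕ) [NeZero N] (K : Type) [Field K] [NumberField K], Summit.BirchSwinnertonDyer.Rank1Residual.Additive.ClassO6 W 3 → Literature.NumberTheory.EllipticCurves.Rank1Residual.Red W 3 → (∃ Φ : AddSubgroup (WeierstrassCurve.geomTorsion W ((3 : ℕ) : ℤ)), Literature.NumberTheory.EllipticCurves.Rank1Residual.IsRationalLine W 3 Φ ∧ ∀ (v : IsDedekindDomain.HeightOneSpectrum (NumberField.RingOfIntegers ℚ)), ((3 : ℕ) : NumberField.RingOfIntegers ℚ) ∈ v.asIdeal → ∀ 𝔓 ∈ v.primesAbove, ¬ (∀ g ∈ 𝔓.decompositionSubgroup (Field.absoluteGaloisGroup ℚ), ∀ P ∈ Φ, g • P = P) ∧ ¬ (∀ g ∈ 𝔓.decompositionSubgroup (Field.absoluteGaloisGroup ℚ), ∀ P : WeierstrassCurve.geomTorsion W ((3 : ℕ) : ℤ), g • P - P ∈ Φ)) → W.conductorNorm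 ℤ = N → Literature.NumberTheory.EllipticCurves.IsImaginaryQuadratic K → Literature.NumberTheory.EllipticCurves.SatisfiesHeegnerHypothesis N K → ∀ (κ : Literature.NumberTheory.EllipticCurves.ZpExtension K 3), κ.IsAnticyclotomic → ∀ (𝔭' : IsDedekindDomain.HeightOneSpectrum (NumberField.RingOfIntegers K)), ((3 : ℕ) : NumberField.RingOfIntegers K) ∈ 𝔭'.asIdeal → Set.Finite {s : Summit.BirchSwinnertonDyer.Rank1Residual.X11b.AcSelmer.selmerAc (W.baseChange K) 3 κ 𝔭' ∅ | (3 : ℕ) • s = 0} := by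
  intro W _ _ N _ K _ _ hO6 _hRed hline hN hK hHg κ hκ 𝔭' h𝔭'
  obtain ⟨Φ, hΦ, hcell⟩ := hline
  haveI : Fact (Nat.Prime 3) := ⟨Nat.prime_three⟩
  haveI hEK : (W.baseChange K).IsElliptic := inferInstanceAs (W.map (algebraMap ℚ K)).IsElliptic
  haveI : IsGalois ℚ K := isGalois_of_finrank_eq_two K hK.1
  /- `3 ∣ N` (additive reduction at `3`), so `3` splits in `K`: `e(𝔭′|3) = f(𝔭′|3) = 1` -/
  have h3N : 3 ∣ N := by
    rw [← hN]
    exact (W.dvd_conductorNorm_iff_not_hasGoodReductionAtPrime 3).mpr hO6.2.1.1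
  have hsplit : ((Ideal.span {((3 : ℕ) : ℤ)}).primesOver (𝓞 K)).ncard = 2 := hHg 3 Nat.prime_three h3N
  have he : 𝔭'.asIdeal.ramificationIdx (𝓞 ℚ) = 1 :=
    ramificationIdx_eq_one_of_card_primesOver K 3 hK.1 hsplit 𝔭' h𝔭'
  have hf : 𝔭'.asIdeal.inertiaDeg (𝓞 ℚ) = 1 :=
    inertiaDeg_eq_one_of_card_primesOver K 3 hK.1 hsplit 𝔭' h𝔭'
  set v₃ : HeightOneSpectrum (𝓞 ℚ) := 𝔭'.under (𝓞 ℚ) with hv₃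
  have hw : 𝔭'.asIdeal.under (𝓞 ℚ) = v₃.asIdeal := by rw [hv₃, HeightOneSpectrum.under_asIdeal]
  have h3v : ((3 : ℕ) : 𝓞 ℚ) ∈ v₃.asIdeal := natCast_mem_under K 3 𝔭' h𝔭'
  have hcellv := hcell v₃ h3v
  /- the line over `K` -/
  obtain ⟨t, ht⟩ := exists_geomTorsion_baseChange_equiv W K ((3 : ℕ) : ℤ)
  have ht' : ∀ (σ : absoluteGaloisGroup K) (P : W.geomTorsion ((3 : ℕ) : ℤ)),
      t (absGaloisRestrict ℚ K σ • P) = σ • t P := fun σ P ↦ by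
    rw [← resGal_eq_absGaloisRestrict]; exact ht σ P
  obtain ⟨S, hS, hcardS⟩ := exists_stableSubgroup_corr Φ t ht' hΦ.2
  have hSub : Nat.card S.Sub = 3 := by rw [hcardS, hΦ.1]
  have hE3 : Nat.card ((W.baseChange K).geomTorsion ((3 : ℕ) : ℤ)) = 3 ^ 2 :=
    (W.baseChange K).natCard_geomTorsion_prime_eq_sq Nat.prime_three
  have hQuot : Nat.card S.Quot = 3 := by
    have h := S.natCard_eq_mul
    rw [hE3, hSub] at h
    omega
  /- the non-anomalous clause on `decomp 𝔭′` -/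
  have hnon1 : ¬ ∀ γ ∈ decomp 𝔭', ∀ x : S.Sub, γ • x = x :=
    not_forall_decomp_smul_sub_eq_of_corr Φ t ht' S hS
      (not_forall_decomp_smul_eq K Φ hw he hf fun 𝔓 h𝔓 ↦ (hcellv 𝔓 h𝔓).1)
  have hnon2 : ¬ ∀ γ ∈ decomp 𝔭', ∀ y : S.Quot, γ • y = y :=
    not_forall_decomp_smul_quot_eq_of_corr Φ t ht' S hS
      (not_forall_decomp_smul_sub_mem K Φ hw he hf fun 𝔓 h𝔓 ↦ (hcellv 𝔓 h𝔓).2)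
  /- no `ker κ ⊓ D_{𝔭′}`-fixed vector in the quotient -/
  have hfix : ∀ y : S.Quot, (∀ g : ↥(κ.kerSubgroup ⊓ decomp 𝔭'), g • y = y) → y = 0 :=
    eq_zero_of_fixed_of_not_forall_decomp_smul_eq κ 𝔭' hQuot hnon2
  /- CGLS's `θ|D ≠ ω` for both characters, from the determinant on the line -/
  obtain ⟨χS, hχS⟩ := exists_character_of_natCard_eq (G := absoluteGaloisGroup K) (A := S.Sub) hSub
  obtain ⟨χQ, hχQ⟩ := exists_character_of_natCard_eq (G := absoluteGaloisGroup K) (A := S.Quot) hQuot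
  have hdetS := hdet K (W.baseChange K) S hSub
  have hωS : ¬ ∀ g ∈ decomp 𝔭', ∀ m : S.Sub,
      g • m = ((modNCyclotomicCharacter K 3 g : (ZMod 3)ˣ) : ZMod 3).val • m := by
    intro h
    apply hnon2
    intro g hg y
    have h1 := hdetS g ((modNCyclotomicCharacter K 3 g : (ZMod 3)ˣ) : ZMod 3).val
      ((χQ g : ZMod 3).val) (h g hg) (fun y ↦ hχQ g y)
    rw [Nat.cast_mul, ZMod.natCast_zmod_val, ZMod.natCast_zmod_val, mul_right_eq_self₀] at h1
    rcases h1 with h1 | h1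
    · rw [hχQ, h1, show ((1 : ZMod 3)).val = 1 from rfl, one_smul]
    · exact absurd h1 (modNCyclotomicCharacter K 3 g).ne_zero
  have hωQ : ¬ ∀ g ∈ decomp 𝔭', ∀ m : S.Quot,
      g • m = ((modNCyclotomicCharacter K 3 g : (ZMod 3)ˣ) : ZMod 3).val • m := by
    intro h
    apply hnon1
    intro g hg x
    have h1 := hdetS g ((χS g : ZMod 3).val)
      ((modNCyclotomicCharacter K 3 g : (ZMod 3)ˣ) : ZMod 3).val (fun x ↦ hχS g x) (h g hg)
    rw [Nat.cast_mul, ZMod.natCast_zmod_val, ZMod.natCast_zmod_val, mul_left_eq_self₀] at h1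
    rcases h1 with h1 | h1
    · rw [hχS, h1, show ((1 : ZMod 3)).val = 1 from rfl, one_smul]
    · exact absurd h1 (modNCyclotomicCharacter K 3 g).ne_zero
  /- the bad places prime to `3` and the unramified condition -/
  set S₀ : Set (HeightOneSpectrum (𝓞 K)) :=
    {v | ((3 : ℕ) : 𝓞 K) ∉ v.asIdeal ∧ ¬ (W.baseChange K).HasGoodReductionAt v} with hS₀
  obtain ⟨hS₀fin, hS₀split⟩ := hbad W N K hN hK hHg
  have hgood : ∀ v : HeightOneSpectrum (𝓞 K), v ∉ S₀ → ((3 : ℕ) : 𝓞 K) ∉ v.asIdeal →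
      (W.baseChange K).HasGoodReductionAt v := fun v hv h3 ↦ by
    by_contra hb
    exact hv ⟨h3, hb⟩
  have hS₀mem : ∀ v ∈ S₀, ((3 : ℕ) : 𝓞 K) ∉ v.asIdeal ∧ ((v.asIdeal.under ℤ).primesOver (𝓞 K)).ncard = 2 :=
    fun v hv ↦ ⟨hv.1, hS₀split v hv.1 hv.2⟩
  have hM : ∀ m : (W.baseChange K).geomTorsion ((3 : ℕ) : ℤ),
      Continuous fun g : absoluteGaloisGroup K ↦ g • m :=
    continuous_smul_geomTorsion (W.baseChange K) ((3 : ℕ) : ℤ)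
  have hunrE : ∀ v : HeightOneSpectrum (𝓞 K), v ∉ S₀ → ((3 : ℕ) : 𝓞 K) ∉ v.asIdeal →
      ∀ x ∈ inertia v, ∀ m : (W.baseChange K).geomTorsion ((3 : ℕ) : ℤ), x • m = m :=
    fun v hv h3 x hx m ↦ smul_geomTorsion_eq_of_mem_inertia_chosen (W.baseChange K) (hgood v hv h3) h3 hx m
  have hunrSub : ∀ v : HeightOneSpectrum (𝓞 K), v ∉ S₀ → ((3 : ℕ) : 𝓞 K) ∉ v.asIdeal →
      ∀ x ∈ inertia v, ∀ m : S.Sub, x • m = m := fun v hv h3 x hx m ↦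
    S.incl_injective (by rw [StableSubgroup.incl_smul]; exact hunrE v hv h3 x hx _)
  have hunrQuot : ∀ v : HeightOneSpectrum (𝓞 K), v ∉ S₀ → ((3 : ℕ) : 𝓞 K) ∉ v.asIdeal →
      ∀ x ∈ inertia v, ∀ m : S.Quot, x • m = m := fun v hv h3 x hx m ↦ by
    obtain ⟨n, rfl⟩ := S.proj_surjective m
    rw [StableSubgroup.smul_proj, hunrE v hv h3 x hx]
  /- Brink: `𝔭′` is finitely decomposed in `K_∞` -/
  have h𝔭dec : ¬ (decomp 𝔭' ≤ κ.kerSubgroup) :=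
    ZpExtension.decomp_not_le_kerSubgroup_above_of_isAnticyclotomic_holds K 3 hK (by norm_num) κ hκ 𝔭' h𝔭'
  /- CGLS Prop. 14 for the two characters -/
  have hΦfin : (datumStrictSelmer κ.kerSubgroup S.Sub 3 (AcSelmer.bdpData S.Sub 3 𝔭') S₀ :
      Set (Literature.NumberTheory.EllipticCurves.subgroupH1 κ.kerSubgroup S.Sub)).Finite :=
    hfact K 3 hK (by norm_num) hsplit κ hκ 𝔭' h𝔭' S.Sub hSub (S.continuous_smul_sub hM) S₀ hS₀fin
      hS₀mem hunrSub hnon1 hωS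
  have hΨfin : (datumStrictSelmer κ.kerSubgroup S.Quot 3 (AcSelmer.bdpData S.Quot 3 𝔭') S₀ :
      Set (Literature.NumberTheory.EllipticCurves.subgroupH1 κ.kerSubgroup S.Quot)).Finite :=
    hfact K 3 hK (by norm_num) hsplit κ hκ 𝔭' h𝔭' S.Quot hQuot (S.continuous_smul_quot hM) S₀ hS₀fin
      hS₀mem hunrQuot hnon2 hωQ
  exact finite_selmerAc_empty_pTorsion_of_line_devissage (W.baseChange K) κ h𝔭' h𝔭dec hgood S hfix
    hΦfin hΨfin

end Summit.BirchSwinnertonDyer.BirchSwinnertonDyer.Theorems.CumulativeHeegnerInclusionAtThreeB1OfPrint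

end
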